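import Summits.HodgeConjecture.CorCM.IrreducibleOddWeightsMultiClassCommutant
import Summits.HodgeConjecture.CorCM.IrreducibleOddWeightsSubfamilyDominationClass
import HarnessLib

/-!
# The multiplicity formula across all isotypic classes, V: TYPE RANKS — `dim Hg(∏_i A_i) = Σ_c r_c·dim A_c`,
# `Hg(∏_i A_i) = ∏_i Hg(A_i) ⟺ ∀ c` the D-spans `D_c⟨b^i_c⟩` are independent, `rank Σ = rank Σ_κ ⟺ ∀ c ∀ i,
# D_c⟨b^i_c⟩ ≤ ⨆_j D_c⟨b^{κ j}_c⟩`

COR-CM (cell `pub-hodgecm2`, binder seat `b16` gen 75, count-neutral claim THE MULTIPLICITY FORMULA ACROSS ALL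
ISOTYPIC CLASSES FOR A WHOLE FAMILY, file M5 — type ranks; theorems only, no definition, no named fact, no `sorry`).
NEW as stated, hence under `Summits/`.  HONEST FRAMING: finite-dimensional linear algebra about the Kubota–Dodson
rank of a family of CM types (`rank Σ − 1 = dim Hg(∏_i A_i)`, `rank Φ_i − 1 = dim Hg(A_i)`, the matrix-coefficient
spaces `MC_i = span{g ↦ u_i(g·x)} ≤ ℚ^G` of gen 64 R1); nothing about Hodge classes is asserted, `HC_CM` is neither
used nor asserted.  Gen 74 S4 (`…SubfamilyDominationClass`) is the case of ONE isotypic class; gen 74 S7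
(`…CommutantDominationClasses`) is the PAIR criterion over all classes; this file does a whole family over all
classes (files M1–M4).

SETTING.  A family of CM types `Φ_i ⊆ E_i` (`i ∈ I` finite) whose TYPE VECTORS are decomposed over pairwise
non-isomorphic reference stable irreducibles `A_c ≤ ℚ^{Y_c}` (`c ∈ C`, `A_c ≠ 0`, commutant `𝒟_c` ANY):
`u_i = Σ_c Σ_j ι^i_{c,j}(b^i_{c,j})` (hypothesis `hu`) for equivariant embeddings `ι^i_{c,j} : A_c → ℚ^{E_i}` jointly
independent on `A_c` for each `(i, c)` and components `b^i_{c,j} ∈ A_c` — the ISOTYPIC DECOMPOSITION of `u_i` in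
`ℚ^{E_i}`, the census side supplies it.  `D_c⟨b^i_c⟩ = ⨆_j D_c·b^i_{c,j}`, `δ_c = dim D_c·a₀_c`.

* **THE MULTIPLICITY FORMULA** (`exists_rank_typeRank_sigmaType_eq_sum_of_classes`): there are `r_c ≤ Σ_i |J_{i,c}|`
  with `dim ⨆_{i,j} D_c·b^i_{c,j} = r_c·δ_c` and **`rank Σ = Σ_c r_c·dim A_c + 1`** (`dim Hg(∏_i A_i) = Σ_c r_c·dim A_c`,
  `r_c` the `D_c`-rank of ALL class-`c` components of all members); one member `exists_rank_typeRank_eq_sum_of_classes`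
  (`dim Hg(A_i) = Σ_c r^i_c·dim A_c`).
* **ADDITIVITY** (`typeRank_sigmaType_add_card_eq_iff_forall_iSupIndep_of_classes`): **`Hg(∏_i A_i) = ∏_i Hg(A_i)`
  (`rank Σ + |I| = Σ_i rank Φ_i + 1`) `⟺` for EVERY class `c` the D-spans `D_c⟨b^i_c⟩ ≤ A_c` (`i ∈ I`) are
  INDEPENDENT**.
* **SUB-FAMILY DOMINATION** (`typeRank_sigmaType_eq_reindex_iff_forall_iSup_le_of_classes`, `κ : I′ → I`):
  **`rank Σ = rank Σ_κ ⟺ ∀ c ∀ i, D_c⟨b^i_c⟩ ≤ ⨆_j D_c⟨b^{κ j}_c⟩`** — the sub-product `∏_{I′} A_{κ j}` carries the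
  whole Hodge theory of `∏_I A_i` iff, class by class, every member's components are `D_c`-combinations of the kept
  ones; `typeRank_sigmaType_eq_iff_forall_iSup_le_of_erase_of_classes` (all but one member).

## References

* [Deligne1982HodgeCycles] P. Deligne, *Hodge cycles on abelian varieties*, LNM 900 (1982), I.3.4, I.5 (p. 53),
  I Ex. 3.7 (c).
* [Gordon1999HodgeAVSurvey] B. B. Gordon, *A survey of the Hodge conjecture for abelian varieties*, §3 Theorem (Imai,
  Murty) with proof, 7.5–7.7, 9.4.3.
* [Lang2002] S. Lang, *Algebra*, 3rd ed., XVII §1, XVII §3.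
* [Serre1977] J.-P. Serre, *Linear Representations of Finite Groups*, GTM 42, §2.6.
* [Mai1989] L. Mai, *Lower bounds for the ranks of CM types*, J. Number Theory 32 (1989), §2 Prop. 1.
-/

set_option autoImplicit false

noncomputable section

open scoped BigOperators Classical

universe u u' uC uJ v vC w

namespace Summit.HodgeConjecture.CorCM.IrrOdd

open Literature.NumberTheory.ComplexMultiplication

variable {G : Type w} [Group G]
  {I : Type u} {E : I → Type v} [∀ i, MulAction G (E i)] [∀ i, Fintype (E i)] [Fintype I] [∀ i, Nonempty (E i)]
  {C : Type uC} [Fintype C] {Yc : C → Type vC} [∀ c, MulAction G (Yc c)] [∀ c, Fintype (Yc c)]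
  {Ar : ∀ c, Submodule ℚ (Yc c → ℚ)} {𝒟 : ∀ c, Submodule ℚ ((Yc c → ℚ) →ₗ[ℚ] (Yc c → ℚ))}
  {JJ : I → C → Type uJ} [∀ i c, Fintype (JJ i c)]

/-! ### §1 The multiplicity formula -/

/-- **THE MULTIPLICITY FORMULA FOR A WHOLE FAMILY ACROSS ALL ISOTYPIC CLASSES**: there are `r_c ≤ Σ_i |J_{i,c}|`
(the `D_c`-rank of all class-`c` components of all members) with `dim ⨆_{i,j} D_c·b^i_{c,j} = r_c·δ_c` and
**`rank Σ = Σ_c r_c·dim A_c + 1`** — `dim Hg(∏_i A_i) = Σ_c r_c·dim A_c` (gen 74 S4 for one class; file M4 for the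
sum over the classes). [cite: Deligne1982HodgeCycles, I.5 (p. 53) and I Ex. 3.7 (c)] [cite: Lang2002, XVII §3]
[cite: Mai1989, §2 Prop. 1 (proof)] -/
theorem exists_rank_typeRank_sigmaType_eq_sum_of_classes [Nonempty I] {ρ : G} {Φ : ∀ i, Set (E i)}
    (h : ∀ i, IsCMTypeWith ρ (Φ i))
    (h𝒟 : ∀ c (L : (Yc c → ℚ) →ₗ[ℚ] (Yc c → ℚ)), L ∈ 𝒟 c ↔ (∀ a ∈ Ar c, L a ∈ Ar c) ∧
      ∀ (k : G) (a : Yc c → ℚ), a ∈ Ar c → L (fun y => a (k • y)) = fun y => L a (k • y))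
    (hRst : ∀ c (k : G) (a : Yc c → ℚ), a ∈ Ar c → (fun y => a (k • y)) ∈ Ar c)
    (hRirr : ∀ c (W : Submodule ℚ (Yc c → ℚ)), W ≤ Ar c → W ≠ ⊥ →
      (∀ (k : G) (f : Yc c → ℚ), f ∈ W → (fun y => f (k • y)) ∈ W) → W = Ar c)
    (hsep : ∀ c c' (L : (Yc c → ℚ) →ₗ[ℚ] (Yc c' → ℚ)), c ≠ c' → Ar c ≠ ⊥ → (∀ a ∈ Ar c, L a ∈ Ar c') →
      (∀ a ∈ Ar c, L a = 0 → a = 0) →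
      (∀ (k : G) (a : Yc c → ℚ), a ∈ Ar c → L (fun y => a (k • y)) = fun y => L a (k • y)) → False)
    (ι : ∀ i c, JJ i c → ((Yc c → ℚ) →ₗ[ℚ] (E i → ℚ)))
    (hιeq : ∀ i c (j : JJ i c) (k : G) (a : Yc c → ℚ), a ∈ Ar c →
      ι i c j (fun y => a (k • y)) = fun y => ι i c j a (k • y))
    (hind : ∀ i c (f : JJ i c → (Yc c → ℚ)), (∀ j, f j ∈ Ar c) → ∑ j, ι i c j (f j) = 0 → ∀ j, f j = 0)
    {b : ∀ i c, JJ i c → (Yc c → ℚ)} (hb : ∀ i c j, b i c j ∈ Ar c)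
    (hu : ∀ i, antiVec (Φ i) (1 : G) = ∑ c, ∑ j, ι i c j (b i c j))
    {a₀ : ∀ c, Yc c → ℚ} (ha₀ : ∀ c, a₀ c ∈ Ar c) (h0 : ∀ c, a₀ c ≠ 0) :
    ∃ r : C → ℕ, (∀ c, r c ≤ ∑ i, Fintype.card (JJ i c)) ∧
      (∀ c, Module.finrank ℚ ↥(⨆ i, ⨆ j, (𝒟 c).map (LinearMap.applyₗ (b i c j))) =
        r c * Module.finrank ℚ ↥((𝒟 c).map (LinearMap.applyₗ (a₀ c)))) ∧
      typeRank G (sigmaType Φ) = (∑ c, r c * Module.finrank ℚ (Ar c)) + 1 := by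
  obtain ⟨i₀⟩ := ‹Nonempty I›
  haveI : Nonempty (Σ i, E i) := ⟨⟨i₀, Classical.arbitrary (E i₀)⟩⟩
  obtain ⟨r, hr, hD, hS⟩ := exists_rank_finrank_iSup_span_shadowCoeff_eq_sum_of_classes (Yf := E) h𝒟 hRst hRirr
    hsep ι hιeq hind hb ha₀ h0
  refine ⟨r, hr, hD, ?_⟩
  rw [(IsCMTypeWith.sigmaType h).typeRank_eq_finrank_antiSpan_add_one,
    finrank_antiSpan_sigmaType_eq_finrank_iSup_span_coeff Φ,
    iSup_congr fun i => span_coeff_eq_span_shadowCoeff_of_eq Φ i (hu i), hS]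

omit [Fintype I] in
/-- **ONE MEMBER: `rank Φ_i = Σ_c r^i_c·dim A_c + 1`** with `dim D_c⟨b^i_c⟩ = r^i_c·δ_c`, `r^i_c ≤ |J_{i,c}|` —
`dim Hg(A_i) = Σ_c r^i_c·dim A_c` (gen 72 C4 per class; file M2 for the sum over the classes).
[cite: Deligne1982HodgeCycles, I.3.4] [cite: Lang2002, XVII §3] -/
theorem exists_rank_typeRank_eq_sum_of_classes {ρ : G} {Φ : ∀ i, Set (E i)} (h : ∀ i, IsCMTypeWith ρ (Φ i))
    (i₀ : I)
    (h𝒟 : ∀ c (L : (Yc c → ℚ) →ₗ[ℚ] (Yc c → ℚ)), L ∈ 𝒟 c ↔ (∀ a ∈ Ar c, L a ∈ Ar c) ∧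
      ∀ (k : G) (a : Yc c → ℚ), a ∈ Ar c → L (fun y => a (k • y)) = fun y => L a (k • y))
    (hRst : ∀ c (k : G) (a : Yc c → ℚ), a ∈ Ar c → (fun y => a (k • y)) ∈ Ar c)
    (hRirr : ∀ c (W : Submodule ℚ (Yc c → ℚ)), W ≤ Ar c → W ≠ ⊥ →
      (∀ (k : G) (f : Yc c → ℚ), f ∈ W → (fun y => f (k • y)) ∈ W) → W = Ar c)
    (hsep : ∀ c c' (L : (Yc c → ℚ) →ₗ[ℚ] (Yc c' → ℚ)), c ≠ c' → Ar c ≠ ⊥ → (∀ a ∈ Ar c, L a ∈ Ar c') →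
      (∀ a ∈ Ar c, L a = 0 → a = 0) →
      (∀ (k : G) (a : Yc c → ℚ), a ∈ Ar c → L (fun y => a (k • y)) = fun y => L a (k • y)) → False)
    (ι : ∀ i c, JJ i c → ((Yc c → ℚ) →ₗ[ℚ] (E i → ℚ)))
    (hιeq : ∀ i c (j : JJ i c) (k : G) (a : Yc c → ℚ), a ∈ Ar c →
      ι i c j (fun y => a (k • y)) = fun y => ι i c j a (k • y))
    (hind : ∀ i c (f : JJ i c → (Yc c → ℚ)), (∀ j, f j ∈ Ar c) → ∑ j, ι i c j (f j) = 0 → ∀ j, f j = 0)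
    {b : ∀ i c, JJ i c → (Yc c → ℚ)} (hb : ∀ i c j, b i c j ∈ Ar c)
    (hu : ∀ i, antiVec (Φ i) (1 : G) = ∑ c, ∑ j, ι i c j (b i c j))
    {a₀ : ∀ c, Yc c → ℚ} (ha₀ : ∀ c, a₀ c ∈ Ar c) (h0 : ∀ c, a₀ c ≠ 0) :
    ∃ r : C → ℕ, (∀ c, r c ≤ Fintype.card (JJ i₀ c)) ∧
      (∀ c, Module.finrank ℚ ↥(⨆ j, (𝒟 c).map (LinearMap.applyₗ (b i₀ c j))) =
        r c * Module.finrank ℚ ↥((𝒟 c).map (LinearMap.applyₗ (a₀ c)))) ∧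
      typeRank G (Φ i₀) = (∑ c, r c * Module.finrank ℚ (Ar c)) + 1 := by
  choose r hr hD hS using fun c => exists_rank_finrank_span_shadowCoeff_sum_eq (Y₀ := E i₀) (h𝒟 c) (hRst c)
    (hRirr c) (ι i₀ c) (hιeq i₀ c) (hind i₀ c) (hb i₀ c) (ha₀ c) (h0 c)
  refine ⟨r, hr, hD, ?_⟩
  rw [(h i₀).typeRank_eq_finrank_antiSpan_add_one, finrank_antiSpan_eq_finrank_span_coeff,
    span_coeff_eq_span_shadowCoeff_of_eq Φ i₀ (hu i₀),
    finrank_span_shadowCoeff_eq_sum_of_classes hRst hRirr hsep (ι i₀) (hιeq i₀) (hind i₀) (hb i₀),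
    Finset.sum_congr rfl fun c _ => hS c]

/-! ### §2 Additivity -/

/-- **ADDITIVITY ACROSS ALL ISOTYPIC CLASSES: `Hg(∏_i A_i) = ∏_i Hg(A_i)` (`rank Σ + |I| = Σ_i rank Φ_i + 1`) IFF for
EVERY class `c` the D-spans `D_c⟨b^i_c⟩ ≤ A_c` (`i ∈ I`) of the members' class-`c` components are INDEPENDENT** (gen 64
R1's «`MC_i` independent», split over the classes by file M3 and read over each commutant by file M4).
[cite: Gordon1999HodgeAVSurvey, §3 Theorem and 7.5–7.7] [cite: Deligne1982HodgeCycles, I.5 (p. 53)]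
[cite: Lang2002, XVII §1 and §3] -/
theorem typeRank_sigmaType_add_card_eq_iff_forall_iSupIndep_of_classes [Nonempty I] {ρ : G} {Φ : ∀ i, Set (E i)}
    (h : ∀ i, IsCMTypeWith ρ (Φ i))
    (h𝒟 : ∀ c (L : (Yc c → ℚ) →ₗ[ℚ] (Yc c → ℚ)), L ∈ 𝒟 c ↔ (∀ a ∈ Ar c, L a ∈ Ar c) ∧
      ∀ (k : G) (a : Yc c → ℚ), a ∈ Ar c → L (fun y => a (k • y)) = fun y => L a (k • y))
    (hRst : ∀ c (k : G) (a : Yc c → ℚ), a ∈ Ar c → (fun y => a (k • y)) ∈ Ar c)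
    (hRirr : ∀ c (W : Submodule ℚ (Yc c → ℚ)), W ≤ Ar c → W ≠ ⊥ →
      (∀ (k : G) (f : Yc c → ℚ), f ∈ W → (fun y => f (k • y)) ∈ W) → W = Ar c)
    (hR0 : ∀ c, Ar c ≠ ⊥)
    (hsep : ∀ c c' (L : (Yc c → ℚ) →ₗ[ℚ] (Yc c' → ℚ)), c ≠ c' → Ar c ≠ ⊥ → (∀ a ∈ Ar c, L a ∈ Ar c') →
      (∀ a ∈ Ar c, L a = 0 → a = 0) →
      (∀ (k : G) (a : Yc c → ℚ), a ∈ Ar c → L (fun y => a (k • y)) = fun y => L a (k • y)) → False)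
    (ι : ∀ i c, JJ i c → ((Yc c → ℚ) →ₗ[ℚ] (E i → ℚ)))
    (hιeq : ∀ i c (j : JJ i c) (k : G) (a : Yc c → ℚ), a ∈ Ar c →
      ι i c j (fun y => a (k • y)) = fun y => ι i c j a (k • y))
    (hind : ∀ i c (f : JJ i c → (Yc c → ℚ)), (∀ j, f j ∈ Ar c) → ∑ j, ι i c j (f j) = 0 → ∀ j, f j = 0)
    {b : ∀ i c, JJ i c → (Yc c → ℚ)} (hb : ∀ i c j, b i c j ∈ Ar c)
    (hu : ∀ i, antiVec (Φ i) (1 : G) = ∑ c, ∑ j, ι i c j (b i c j)) :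
    typeRank G (sigmaType Φ) + Fintype.card I = (∑ i, typeRank G (Φ i)) + 1 ↔
      ∀ c, iSupIndep fun i => ⨆ j, (𝒟 c).map (LinearMap.applyₗ (b i c j)) := by
  have hfun : (fun i => Submodule.span ℚ (Set.range fun x : E i => fun g : G => antiVec (Φ i) g x)) =
      fun i => Submodule.span ℚ (Set.range fun x : E i => fun g : G => (∑ c, ∑ j, ι i c j (b i c j)) (g • x)) :=
    funext fun i => span_coeff_eq_span_shadowCoeff_of_eq Φ i (hu i)
  rw [typeRank_sigmaType_add_card_eq_iff_iSupIndep h, hfun]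
  exact iSupIndep_span_shadowCoeff_iff_forall_iSupIndep_of_classes (Yf := E) h𝒟 hRst hRirr hR0 hsep ι hιeq hind hb

/-! ### §3 Sub-family domination -/

/-- **SUB-FAMILY DOMINATION ACROSS ALL ISOTYPIC CLASSES: `rank Σ = rank Σ_κ ⟺ ∀ c ∀ i, D_c⟨b^i_c⟩ ≤ ⨆_j D_c⟨b^{κ j}_c⟩`**
(`κ : I′ → I`): `dim MT(∏_I A_i) = dim MT(∏_{I′} A_{κ j})` — every member is Hodge-dominated by the sub-product — iff
in every class every member's components are `D_c`-combinations of the kept members' components (gen 74 S1's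
`MC_i ≤ ⨆_j MC_{κ j}`, files M3/M4 class by class). [cite: Deligne1982HodgeCycles, I.5 (p. 53)]
[cite: Gordon1999HodgeAVSurvey, 7.5–7.7] [cite: Lang2002, XVII §3] -/
theorem typeRank_sigmaType_eq_reindex_iff_forall_iSup_le_of_classes {ρ : G} {Φ : ∀ i, Set (E i)}
    (h : ∀ i, IsCMTypeWith ρ (Φ i)) {I' : Type u'} [Fintype I'] (κ : I' → I) [Nonempty I']
    (h𝒟 : ∀ c (L : (Yc c → ℚ) →ₗ[ℚ] (Yc c → ℚ)), L ∈ 𝒟 c ↔ (∀ a ∈ Ar c, L a ∈ Ar c) ∧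
      ∀ (k : G) (a : Yc c → ℚ), a ∈ Ar c → L (fun y => a (k • y)) = fun y => L a (k • y))
    (hRst : ∀ c (k : G) (a : Yc c → ℚ), a ∈ Ar c → (fun y => a (k • y)) ∈ Ar c)
    (hRirr : ∀ c (W : Submodule ℚ (Yc c → ℚ)), W ≤ Ar c → W ≠ ⊥ →
      (∀ (k : G) (f : Yc c → ℚ), f ∈ W → (fun y => f (k • y)) ∈ W) → W = Ar c)
    (hR0 : ∀ c, Ar c ≠ ⊥)
    (hsep : ∀ c c' (L : (Yc c → ℚ) →ₗ[ℚ] (Yc c' → ℚ)), c ≠ c' → Ar c ≠ ⊥ → (∀ a ∈ Ar c, L a ∈ Ar c') →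
      (∀ a ∈ Ar c, L a = 0 → a = 0) →
      (∀ (k : G) (a : Yc c → ℚ), a ∈ Ar c → L (fun y => a (k • y)) = fun y => L a (k • y)) → False)
    (ι : ∀ i c, JJ i c → ((Yc c → ℚ) →ₗ[ℚ] (E i → ℚ)))
    (hιeq : ∀ i c (j : JJ i c) (k : G) (a : Yc c → ℚ), a ∈ Ar c →
      ι i c j (fun y => a (k • y)) = fun y => ι i c j a (k • y))
    (hind : ∀ i c (f : JJ i c → (Yc c → ℚ)), (∀ j, f j ∈ Ar c) → ∑ j, ι i c j (f j) = 0 → ∀ j, f j = 0)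
    {b : ∀ i c, JJ i c → (Yc c → ℚ)} (hb : ∀ i c j, b i c j ∈ Ar c)
    (hu : ∀ i, antiVec (Φ i) (1 : G) = ∑ c, ∑ j, ι i c j (b i c j)) :
    typeRank G (sigmaType Φ) = typeRank G (sigmaType fun j => Φ (κ j)) ↔
      ∀ c i, (⨆ j, (𝒟 c).map (LinearMap.applyₗ (b i c j))) ≤
        ⨆ j', ⨆ j, (𝒟 c).map (LinearMap.applyₗ (b (κ j') c j)) := by
  obtain ⟨j₀⟩ := ‹Nonempty I'›
  haveI : Nonempty (Σ j, E (κ j)) := ⟨⟨j₀, Classical.arbitrary (E (κ j₀))⟩⟩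
  have hcoeff : ∀ i, Submodule.span ℚ (Set.range fun x : E i => fun g : G => antiVec (Φ i) g x) =
      Submodule.span ℚ (Set.range fun x : E i => fun g : G => (∑ c, ∑ j, ι i c j (b i c j)) (g • x)) :=
    fun i => span_coeff_eq_span_shadowCoeff_of_eq Φ i (hu i)
  rw [typeRank_sigmaType_eq_reindex_iff_forall_span_coeff_le h κ]
  simp only [hcoeff]
  refine (forall_congr' fun i => ?_).trans forall_comm
  exact span_shadowCoeff_le_iSup_iff_forall_iSup_le_of_classes (Yf := fun j' => E (κ j'))
    (JJ := fun j' c => JJ (κ j') c) h𝒟 hRst hRirr hR0 hsep (fun j' c => ι (κ j') c) (ι i)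
    (fun j' c => hιeq (κ j') c) (hιeq i) (fun j' c => hind (κ j') c) (hind i) (fun j' c => hb (κ j') c) (hb i)

/-- **ALL BUT ONE MEMBER: `rank Σ = rank Σ|_{I∖{i₀}} ⟺ ∀ c, D_c⟨b^{i₀}_c⟩ ≤ ⨆_{i ≠ i₀} D_c⟨b^i_c⟩`** — dropping
`A_{i₀}` from the product keeps `dim MT` iff in every class its components are `D_c`-combinations of the others'.
[cite: Deligne1982HodgeCycles, I.5 (p. 53)] [cite: Gordon1999HodgeAVSurvey, 7.5–7.7] [cite: Lang2002, XVII §3] -/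
theorem typeRank_sigmaType_eq_iff_forall_iSup_le_of_erase_of_classes {ρ : G} {Φ : ∀ i, Set (E i)}
    (h : ∀ i, IsCMTypeWith ρ (Φ i)) (i₀ : I) [Nonempty {i // i ≠ i₀}]
    (h𝒟 : ∀ c (L : (Yc c → ℚ) →ₗ[ℚ] (Yc c → ℚ)), L ∈ 𝒟 c ↔ (∀ a ∈ Ar c, L a ∈ Ar c) ∧
      ∀ (k : G) (a : Yc c → ℚ), a ∈ Ar c → L (fun y => a (k • y)) = fun y => L a (k • y))
    (hRst : ∀ c (k : G) (a : Yc c → ℚ), a ∈ Ar c → (fun y => a (k • y)) ∈ Ar c)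
    (hRirr : ∀ c (W : Submodule ℚ (Yc c → ℚ)), W ≤ Ar c → W ≠ ⊥ →
      (∀ (k : G) (f : Yc c → ℚ), f ∈ W → (fun y => f (k • y)) ∈ W) → W = Ar c)
    (hR0 : ∀ c, Ar c ≠ ⊥)
    (hsep : ∀ c c' (L : (Yc c → ℚ) →ₗ[ℚ] (Yc c' → ℚ)), c ≠ c' → Ar c ≠ ⊥ → (∀ a ∈ Ar c, L a ∈ Ar c') →
      (∀ a ∈ Ar c, L a = 0 → a = 0) →
      (∀ (k : G) (a : Yc c → ℚ), a ∈ Ar c → L (fun y => a (k • y)) = fun y => L a (k • y)) → False)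
    (ι : ∀ i c, JJ i c → ((Yc c → ℚ) →ₗ[ℚ] (E i → ℚ)))
    (hιeq : ∀ i c (j : JJ i c) (k : G) (a : Yc c → ℚ), a ∈ Ar c →
      ι i c j (fun y => a (k • y)) = fun y => ι i c j a (k • y))
    (hind : ∀ i c (f : JJ i c → (Yc c → ℚ)), (∀ j, f j ∈ Ar c) → ∑ j, ι i c j (f j) = 0 → ∀ j, f j = 0)
    {b : ∀ i c, JJ i c → (Yc c → ℚ)} (hb : ∀ i c j, b i c j ∈ Ar c)
    (hu : ∀ i, antiVec (Φ i) (1 : G) = ∑ c, ∑ j, ι i c j (b i c j)) :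
    typeRank G (sigmaType Φ) = typeRank G (sigmaType fun i : {i // i ≠ i₀} => Φ i.1) ↔
      ∀ c, (⨆ j, (𝒟 c).map (LinearMap.applyₗ (b i₀ c j))) ≤
        ⨆ i : {i // i ≠ i₀}, ⨆ j, (𝒟 c).map (LinearMap.applyₗ (b i.1 c j)) := by
  rw [typeRank_sigmaType_eq_reindex_iff_forall_iSup_le_of_classes h (fun i : {i // i ≠ i₀} => i.1) h𝒟 hRst
    hRirr hR0 hsep ι hιeq hind hb hu]
  refine forall_congr' fun c => ⟨fun hall => hall i₀, fun h₀ i => ?_⟩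
  by_cases hi : i = i₀
  · subst hi
    exact h₀
  · exact le_iSup_of_le ⟨i, hi⟩ le_rfl

end Summit.HodgeConjecture.CorCM.IrrOdd

end
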